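import Mathlib.MeasureTheory.Measure.Hausdorff
import Mathlib.Geometry.Euclidean.Volume.Measure
import Mathlib.Topology.Algebra.Module.FiniteDimension
import Mathlib.MeasureTheory.Integral.Lebesgue.Add
import Mathlib.LinearAlgebra.Complex.FiniteDimensional
import HarnessLib

/-!
# Finiteness and vanishing of Hausdorff measures in finite-dimensional normed spaces

Elementary facts about the `d`-dimensional Hausdorff measure `μH[d]` of Mathlib on a
finite-dimensional real (or complex) normed space `W`, used in the proof of Lelong's theorem on
the locally finite volume of complex analytic sets
(`Literature/Geometry/Kaehler/HolomorphicChainFacts.lean`).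

Bounded sets have finite `μH[dim_ℝ W]`-measure directly from Mathlib: `μH[dim_ℝ W]` is an
additive Haar measure (`MeasureTheory.isAddHaarMeasure_hausdorffMeasure`), so
`Bornology.IsBounded.measure_lt_top` applies; this file records the consequences

* `hausdorffMeasure_eq_zero_of_finrank_lt` — `μH[d] = 0` on `W` when `dim_ℝ W < d`, and the
  Lipschitz-image form `hausdorffMeasure_image_eq_zero_of_finrank_lt`;
* `hausdorffMeasure_two_mul_lt_top_of_isBounded`, `hausdorffMeasure_two_mul_eq_zero_of_finrank_lt`
  — the complex forms (`dim_ℝ = 2 dim_ℂ`);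
* `tsum_measure_le_of_card_le` — the counting inequality `Σᵢ μ (P i) ≤ K • μ B` for a
  countable family of measurable subsets `P i ⊆ B` covering every point at most `K` times;
* `euclideanHausdorffMeasure_lt_top_iff` — `μHE[d] s < ∞ ↔ μH[d] s < ∞` for the
  Euclidean-normalised Hausdorff measure `μHE[d] = c • μH[d]` of Mathlib.

## References

* H. Federer, *Geometric Measure Theory*, Springer 1969, 2.10.11, 2.10.35, 3.2.27 [Federer1969].
-/

open scoped ENNReal NNReal Topology
open Set Filter MeasureTheory MeasureTheory.Measure

namespace Literature.Geometry.GeometricMeasureTheory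

/-! ### Vanishing of `μH[d]` above the dimension -/

section FiniteDim

variable {W : Type*} [NormedAddCommGroup W] [NormedSpace ℝ W] [FiniteDimensional ℝ W]
  [MeasurableSpace W] [BorelSpace W]

/-- In a finite-dimensional real normed space `W`, the Hausdorff measures of dimension
`d > dim_ℝ W` vanish identically (bounded pieces have finite `μH[dim W]`-measure by
`Bornology.IsBounded.measure_lt_top`, `μH[dim W]` being an additive Haar measure, hence zero
`μH[d]`-measure by `MeasureTheory.Measure.hausdorffMeasure_zero_or_top`). [folklore] -/
theorem hausdorffMeasure_eq_zero_of_finrank_lt {d : ℝ} (hd : (Module.finrank ℝ W : ℝ) < d)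
    (s : Set W) : μH[d] s = 0 := by
  have hcov : s = ⋃ k : ℕ, s ∩ Metric.ball (0 : W) k := by
    rw [← Set.inter_iUnion, Metric.iUnion_ball_nat, Set.inter_univ]
  rw [hcov]
  refine measure_iUnion_null fun k => ?_
  rcases hausdorffMeasure_zero_or_top hd (s ∩ Metric.ball (0 : W) k) with h | h
  · exact h
  · exact absurd h (Metric.isBounded_ball.subset Set.inter_subset_right).measure_lt_top.ne

/-- A Lipschitz image of a subset of a finite-dimensional real normed space `W` is `μH[d]`-null
for every `d > dim_ℝ W`. [folklore] -/
theorem hausdorffMeasure_image_eq_zero_of_finrank_lt {X : Type*} [EMetricSpace X]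
    [MeasurableSpace X] [BorelSpace X] {K : ℝ≥0} {f : W → X} {s : Set W}
    (hf : LipschitzOnWith K f s) {d : ℝ} (hd : (Module.finrank ℝ W : ℝ) < d) :
    μH[d] (f '' s) = 0 := by
  have h := hf.hausdorffMeasure_image_le (d := d) (by
    have : (0 : ℝ) ≤ Module.finrank ℝ W := Nat.cast_nonneg _
    linarith)
  rw [hausdorffMeasure_eq_zero_of_finrank_lt hd, mul_zero] at h
  exact nonpos_iff_eq_zero.1 h

end FiniteDim

/-! ### Complex normed spaces: real dimension `2 · dim_ℂ` -/

section Complex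

variable {W : Type*} [NormedAddCommGroup W] [NormedSpace ℂ W] [FiniteDimensional ℂ W]
  [MeasurableSpace W] [BorelSpace W]

/-- Bounded subsets of a complex normed space of dimension `q` have finite `μH[2q]`-measure
(`Bornology.IsBounded.measure_lt_top` for the additive Haar measure `μH[dim_ℝ W]`,
`MeasureTheory.isAddHaarMeasure_hausdorffMeasure`, and `dim_ℝ W = 2q`). [folklore] -/
theorem hausdorffMeasure_two_mul_lt_top_of_isBounded {s : Set W} (hs : Bornology.IsBounded s) :
    μH[2 * Module.finrank ℂ W] s < ∞ := by
  letI : NormedSpace ℝ W := NormedSpace.restrictScalars ℝ ℂ W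
  have h : μH[Module.finrank ℝ W] s < ∞ := hs.measure_lt_top
  rw [finrank_real_of_complex] at h
  exact_mod_cast h

/-- Subsets of a complex normed space of dimension `< q` are `μH[2q]`-null. [folklore] -/
theorem hausdorffMeasure_two_mul_eq_zero_of_finrank_lt {q : ℕ} (hq : Module.finrank ℂ W < q)
    (s : Set W) : μH[2 * q] s = 0 := by
  letI : NormedSpace ℝ W := NormedSpace.restrictScalars ℝ ℂ W
  have hd : (Module.finrank ℝ W : ℝ) < (2 * q : ℕ) := by
    rw [finrank_real_of_complex]
    exact_mod_cast (by omega : 2 * Module.finrank ℂ W < 2 * q)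
  have h := hausdorffMeasure_eq_zero_of_finrank_lt hd s
  exact_mod_cast h

/-- A Lipschitz image of a subset of a complex normed space of dimension `< q` is `μH[2q]`-null.
[folklore] -/
theorem hausdorffMeasure_two_mul_image_eq_zero_of_finrank_lt {X : Type*} [EMetricSpace X]
    [MeasurableSpace X] [BorelSpace X] {K : ℝ≥0} {f : W → X} {s : Set W}
    (hf : LipschitzOnWith K f s) {q : ℕ} (hq : Module.finrank ℂ W < q) :
    μH[2 * q] (f '' s) = 0 := by
  letI : NormedSpace ℝ W := NormedSpace.restrictScalars ℝ ℂ W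
  have hd : (Module.finrank ℝ W : ℝ) < (2 * q : ℕ) := by
    rw [finrank_real_of_complex]
    exact_mod_cast (by omega : 2 * Module.finrank ℂ W < 2 * q)
  have h := hausdorffMeasure_image_eq_zero_of_finrank_lt hf hd
  exact_mod_cast h

end Complex

/-! ### The counting inequality -/

section Counting

variable {α : Type*} [MeasurableSpace α] {μ : Measure α}

/-- **Counting inequality.** If `P i ⊆ B` (`i` in a countable index type) are measurable sets
such that every point lies in at most `K` of them (every finite set of indices `i` with `y ∈ P i`
has at most `K` elements), then `Σᵢ μ (P i) ≤ K · μ B`: integrate the pointwise inequality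
`Σᵢ 𝟙_{P i} ≤ K 𝟙_B`. [cite: Federer1969, 3.2.27 (multiplicity form)] -/
theorem tsum_measure_le_of_card_le {ι : Type*} [Countable ι] {P : ι → Set α} {B : Set α}
    (hP : ∀ i, MeasurableSet (P i)) (hPB : ∀ i, P i ⊆ B) {K : ℕ}
    (hK : ∀ y, ∀ F : Finset ι, (∀ i ∈ F, y ∈ P i) → F.card ≤ K) :
    ∑' i, μ (P i) ≤ K * μ B := by
  classical
  -- pointwise bound on the sum of the indicators
  have hpt : ∀ y, ∑' i, (P i).indicator (1 : α → ℝ≥0∞) y ≤ (K : ℝ≥0∞) * B.indicator 1 y := by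
    intro y
    rw [ENNReal.tsum_eq_iSup_sum]
    refine iSup_le fun F => ?_
    have hsum : ∑ i ∈ F, (P i).indicator (1 : α → ℝ≥0∞) y =
        ((F.filter fun i => y ∈ P i).card : ℝ≥0∞) := by
      rw [Finset.card_eq_sum_ones, Nat.cast_sum, Finset.sum_filter]
      refine Finset.sum_congr rfl fun i _ => ?_
      by_cases hy : y ∈ P i <;> simp [hy]
    rw [hsum]
    by_cases hyB : y ∈ B
    · rw [Set.indicator_of_mem hyB, Pi.one_apply, mul_one]
      exact_mod_cast hK y _ fun i hi => (Finset.mem_filter.1 hi).2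
    · have h0 : (F.filter fun i => y ∈ P i) = ∅ := by
        refine Finset.filter_eq_empty_iff.2 fun i _ hy => hyB (hPB i hy)
      simp [h0]
  calc ∑' i, μ (P i) = ∑' i, ∫⁻ y, (P i).indicator 1 y ∂μ := by
        congr 1 with i; rw [lintegral_indicator_one (hP i)]
    _ = ∫⁻ y, ∑' i, (P i).indicator 1 y ∂μ :=
        (lintegral_tsum fun i => ((measurable_one.indicator (hP i)).aemeasurable)).symm
    _ ≤ ∫⁻ y, (K : ℝ≥0∞) * B.indicator 1 y ∂μ := lintegral_mono hpt
    _ ≤ K * μ B := by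
        rw [lintegral_const_mul' _ _ (ENNReal.natCast_ne_top K)]
        gcongr
        exact lintegral_indicator_one_le B

end Counting

/-! ### Euclidean-normalised Hausdorff measure -/

section Euclidean

variable {X : Type*} [EMetricSpace X] [MeasurableSpace X] [BorelSpace X]

/-- `μHE[d] s < ∞ ↔ μH[d] s < ∞`: the Euclidean-normalised Hausdorff measure of Mathlib is a
non-zero finite multiple of `μH[d]`. [folklore] -/
theorem euclideanHausdorffMeasure_lt_top_iff {d : ℕ} {s : Set X} :
    (μHE[d] : Measure X) s < ∞ ↔ μH[d] s < ∞ := by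
  rw [euclideanHausdorffMeasure_def, Measure.smul_apply, ENNReal.smul_def, smul_eq_mul]
  constructor
  · intro h
    by_contra htop
    rw [not_lt, top_le_iff] at htop
    rw [htop, ENNReal.mul_top (by
      exact_mod_cast addHaarScalarFactor_volume_hausdorffMeasure_ne_zero d)] at h
    exact lt_irrefl _ h
  · intro h
    exact ENNReal.mul_lt_top ENNReal.coe_lt_top h

end Euclidean

end Literature.Geometry.GeometricMeasureTheory
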